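import Mathlib
import HarnessLib
import Summits.HubbardSuperconductivity.HubbardSuperconductivity.Theorems.KLProgrammeKLRegimeCountertermJacksonLowPart
import Summits.HubbardSuperconductivity.HubbardSuperconductivity.Theorems.KLProgrammeKLRegimeCountertermJacksonTranslate
import Summits.HubbardSuperconductivity.HubbardSuperconductivity.Theorems.KLProgrammeKLRegimeSplitEvalDerivBounds

/-!
# Route `KLProgramme`, crux K3 — gen-5 ENGINE child (`stub_twoLeg_step`, (E3a-MS) supplier, recipe (L)+(F), plan g12 STATUS l.1769):
# the LOW PART of the Jackson frequency split, II — the BERNSTEIN-TYPE bound `‖Dⁱ(jlow d g)‖ ≤ 12(2d+1)(1+4d)ⁱ·sup|g|`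
# (every derivative of the low part costs `≲ d`, the amplitude is the SUP of `g`, the extra loss is `2d+1`)

Seat hubbard-kl-k3c3-p1 (g3), package (P1) of MS-DESIGN-NOTE §3–§4 (evidence #29 on stmt-…-19855).  In the (F) step the low parts
`jlow d (Kp m°)` (`d = 4ⁿ`) of the mean-free deep frame pieces are merged into the scale-`n` part `lp n`; the budget bookkeeping needs their
derivatives bounded by the piece's SUP (`a₀(m) = Gfr₀·U·16^{−m}`, summable in m) times `dᵏ = 4^{kn}` (the scale-`n` grading), with an extra loss of
at most `O(d)` (MS-DESIGN-NOTE §3: the term table has a spare `4^{−n}` exactly there).  Route: the low part IS the `TrigPolyC4v` `jlowFrame d g`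
(part I), p1b's all-order bound `‖Dⁱ evalM K‖ ≤ coeffNorm i K` (`…SplitEvalDerivBounds`), and a bound of the coefficient weight:
`|ĵ_k| ≤ 1/π` (orthogonality + positivity + mass one) and the finite two-dimensional BESSEL inequality for the double cosine system,
`Σ_{k,l ≤ K} A_h(k,l)²/(N_k N_l) ≤ ∫∫ h²`, whence `Σ_{k,l ≤ K} |A_h(k,l)| ≤ 4π²(K+1)·sup|h|` (Cauchy–Schwarz) — loss `K + 1 = 2d + 1`, not `(2d+1)²`.

* §1 `integral_cos_intMul` / `integral_cos_mul_cos` (orthogonality of `cos(k·)` on `[−π, π]`, norms `cosNorm k = 2π, π`);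
* §2 `integral_jker_mul_cos`, **`abs_jkerCoeff_le`** (`|ĵ_k| ≤ 1/π`);
* §3 `cosMoment_eq_integral_prod`, `integral_cosProd_mul_cosProd`, **`bessel_cosMoment`**, **`sum_abs_cosMoment_le`**;
* §4 **`coeffNorm_jlowFrame_le`**, **`norm_iteratedFDeriv_jlow_le`**: for a symmetric frame `g` with `|g| ≤ A`,
  `‖Dⁱ (q ↦ jlow d g (ofLp q))‖ ≤ 12(2d+1)(1+4d)ⁱ·A` at every `q`, every `i`.

Pure real analysis; nothing about the model.
-/

noncomputable section

namespace Summit.HubbardSuperconductivity.HubbardSuperconductivity.Theorems.KLRegimeSplit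

set_option linter.dupNamespace false -- summit = problem name (single-conjunct summit), D-0017

open Real Finset MeasureTheory intervalIntegral
open Literature.MathematicalPhysics.QuantumLattice Literature.Analysis.Fourier.TrigApprox

/-! ## §1 Orthogonality of the cosine system on `[−π, π]` -/

/-- `∫_{−π}^{π} cos(c·s) ds = 0` for a nonzero INTEGER frequency `c`. -/
theorem integral_cos_intMul {c : ℝ} (z : ℤ) (hcz : c = z) (hc : c ≠ 0) : ∫ s in (-π)..π, Real.cos (c * s) = 0 := by
  rw [intervalIntegral.integral_comp_mul_left (fun s => Real.cos s) hc, integral_cos, hcz]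
  rw [show (z : ℝ) * π = z * π from rfl, show (z : ℝ) * -π = -(z * π) by ring, Real.sin_neg, Real.sin_int_mul_pi]
  simp

/-- The squared norms of the cosine system on `[−π, π]`: `2π` for `k = 0`, `π` for `k ≥ 1`. -/
def cosNorm (k : ℕ) : ℝ := if k = 0 then 2 * π else π

/-- `cosNorm k > 0`. -/
theorem cosNorm_pos (k : ℕ) : 0 < cosNorm k := by
  unfold cosNorm; split_ifs <;> positivity

/-- `cosNorm k ≤ 2π`. -/
theorem cosNorm_le (k : ℕ) : cosNorm k ≤ 2 * π := by
  unfold cosNorm; split_ifs <;> linarith [Real.pi_pos]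

/-- `π ≤ cosNorm k`. -/
theorem pi_le_cosNorm (k : ℕ) : π ≤ cosNorm k := by
  unfold cosNorm; split_ifs <;> linarith [Real.pi_pos]

/-- **Orthogonality**: `∫_{−π}^{π} cos(m s) cos(k s) ds = [m = k]·cosNorm k`. -/
theorem integral_cos_mul_cos (m k : ℕ) :
    ∫ s in (-π)..π, Real.cos (m * s) * Real.cos (k * s) = if m = k then cosNorm k else 0 := by
  have hprod : ∀ s : ℝ, Real.cos (m * s) * Real.cos (k * s) =
      (Real.cos (((m : ℝ) + k) * s) + Real.cos (((m : ℝ) - k) * s)) / 2 := by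
    intro s
    rw [show ((m : ℝ) + k) * s = m * s + k * s by ring, show ((m : ℝ) - k) * s = m * s - k * s by ring,
      Real.cos_add, Real.cos_sub]
    ring
  simp_rw [hprod]
  rw [intervalIntegral.integral_div, intervalIntegral.integral_add (Continuous.intervalIntegrable (by fun_prop) _ _)
    (Continuous.intervalIntegrable (by fun_prop) _ _)]
  by_cases hmk : m = k
  · subst hmk
    rw [if_pos rfl]
    have h2 : ∫ s in (-π)..π, Real.cos (((m : ℝ) - m) * s) = 2 * π := by
      simp
      ring
    rw [h2]
    by_cases hm : m = 0
    · subst hm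
      simp [cosNorm]
      ring
    · have h1 : ∫ s in (-π)..π, Real.cos (((m : ℝ) + m) * s) = 0 :=
        integral_cos_intMul ((m : ℤ) + m) (by push_cast; ring) (by positivity)
      rw [h1, cosNorm, if_neg hm]; ring
  · rw [if_neg hmk]
    have hne : (m : ℝ) - k ≠ 0 := by
      intro h; exact hmk (by exact_mod_cast (sub_eq_zero.mp h))
    have hne' : (m : ℝ) + k ≠ 0 := by
      intro h
      have : (m : ℝ) = 0 ∧ (k : ℝ) = 0 := by
        constructor <;> linarith [(Nat.cast_nonneg m : (0:ℝ) ≤ m), (Nat.cast_nonneg k : (0:ℝ) ≤ k)]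
      exact hmk (by exact_mod_cast this.1.trans this.2.symm)
    rw [integral_cos_intMul ((m : ℤ) + k) (by push_cast; ring) hne', integral_cos_intMul ((m : ℤ) - k) (by push_cast; ring) hne]
    simp

/-! ## §2 The Jackson coefficients are bounded by `1/π` -/

/-- `∫_{−π}^{π} J̃_d(s) cos(k s) ds = ĵ_k · cosNorm k` for `k ≤ 2d` (orthogonality on the cosine expansion `jker_eq_cosPoly`). -/
theorem integral_jker_mul_cos (d : ℕ) {k : ℕ} (hk : k ≤ d + d) :
    ∫ s in (-π)..π, jker d s * Real.cos (k * s) = jkerCoeff d k * cosNorm k := by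
  have hexp : ∀ s, jker d s * Real.cos (k * s) =
      ∑ m ∈ range (d + d + 1), jkerCoeff d m * (Real.cos (m * s) * Real.cos (k * s)) := by
    intro s; rw [jker_eq_cosPoly, Finset.sum_mul]
    exact Finset.sum_congr rfl fun m _ => by ring
  simp_rw [hexp]
  rw [intervalIntegral.integral_finsetSum (fun m _ => Continuous.intervalIntegrable (by fun_prop) _ _)]
  simp_rw [intervalIntegral.integral_const_mul, integral_cos_mul_cos]
  rw [Finset.sum_eq_single k (fun m _ hmk => by rw [if_neg hmk, mul_zero]) (fun hk' => absurd (mem_range.mpr (by omega)) hk')]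
  rw [if_pos rfl]

/-- **`|ĵ_k| ≤ 1/π`** for every `k ≤ 2d` (`|∫ J̃ cos| ≤ ∫ J̃ = 1`, `cosNorm ≥ π`). -/
theorem abs_jkerCoeff_le (d : ℕ) {k : ℕ} (hk : k ≤ d + d) : |jkerCoeff d k| ≤ 1 / π := by
  have hππ : -π ≤ π := by linarith [Real.pi_pos]
  have h := integral_jker_mul_cos d hk
  have hbound : |∫ s in (-π)..π, jker d s * Real.cos (k * s)| ≤ 1 := by
    calc |∫ s in (-π)..π, jker d s * Real.cos (k * s)| ≤ ∫ s in (-π)..π, |jker d s * Real.cos (k * s)| :=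
          intervalIntegral.abs_integral_le_integral_abs hππ
      _ ≤ ∫ s in (-π)..π, jker d s := by
          refine intervalIntegral.integral_mono_on hππ ((Continuous.intervalIntegrable (by
            exact ((continuous_jker d).mul (by fun_prop)).abs) _ _)) ((continuous_jker d).intervalIntegrable _ _) fun s _ => ?_
          rw [abs_mul, abs_of_nonneg (jker_nonneg d s)]
          exact mul_le_of_le_one_right (jker_nonneg d s) (Real.abs_cos_le_one _)
      _ = 1 := integral_jker d
  rw [h, abs_mul, abs_of_pos (cosNorm_pos k)] at hbound
  have hN := pi_le_cosNorm k
  rw [le_div_iff₀ Real.pi_pos]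
  calc |jkerCoeff d k| * π ≤ |jkerCoeff d k| * cosNorm k := mul_le_mul_of_nonneg_left hN (abs_nonneg _)
    _ ≤ 1 := hbound

/-! ## §3 The finite two-dimensional Bessel inequality for the double cosine system -/

section Bessel

/-- The double cosine `e_{kl}(s,u) = cos(k s) cos(l u)` on `ℝ × ℝ`. -/
def cosProd (k l : ℕ) (w : ℝ × ℝ) : ℝ := Real.cos (k * w.1) * Real.cos (l * w.2)

/-- `cosProd` is continuous. -/
theorem continuous_cosProd (k l : ℕ) : Continuous (cosProd k l) := by unfold cosProd; fun_prop

/-- `|cosProd| ≤ 1`. -/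
theorem abs_cosProd_le (k l : ℕ) (w : ℝ × ℝ) : |cosProd k l w| ≤ 1 := by
  unfold cosProd; rw [abs_mul]
  exact mul_le_one₀ (Real.abs_cos_le_one _) (abs_nonneg _) (Real.abs_cos_le_one _)

/-- **Orthogonality of the double cosines** against the square's measure:
`∫ e_{kl}·e_{k'l'} = [k=k']cosNorm k · [l=l']cosNorm l`. -/
theorem integral_cosProd_mul_cosProd (k l k' l' : ℕ) :
    ∫ w, cosProd k l w * cosProd k' l' w ∂jmeas = (if k = k' then cosNorm k else 0) * (if l = l' then cosNorm l else 0) := by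
  have hππ : -π ≤ π := by linarith [Real.pi_pos]
  have e : (fun w : ℝ × ℝ => cosProd k l w * cosProd k' l' w) =
      fun w => (Real.cos (k * w.1) * Real.cos (k' * w.1)) * (Real.cos (l * w.2) * Real.cos (l' * w.2)) := by
    funext w; simp only [cosProd]; ring
  rw [e, MeasureTheory.integral_prod_mul (μ := volume.restrict (Set.Ioc (-π) π)) (ν := volume.restrict (Set.Ioc (-π) π))
    (f := fun s => Real.cos (k * s) * Real.cos (k' * s)) (g := fun u => Real.cos (l * u) * Real.cos (l' * u))]
  simp only [← intervalIntegral.integral_of_le hππ, integral_cos_mul_cos]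
  by_cases h1 : k = k' <;> by_cases h2 : l = l' <;> simp [h1, h2]

variable {h : (Fin 2 → ℝ) → ℝ}

/-- The cosine moment as ONE integral against the square's measure: `A_h(k,l) = ∫ e_{kl}(w)·h(w)`. -/
theorem cosMoment_eq_integral_prod (hh : Continuous h) (k l : ℕ) :
    cosMoment h k l = ∫ w, cosProd k l w * h ![w.1, w.2] ∂jmeas := by
  have hππ : -π ≤ π := by linarith [Real.pi_pos]
  have hF : Continuous fun q : ℝ × ℝ => h ![q.1, q.2] := by
    refine hh.comp (continuous_pi fun i => ?_)
    fin_cases i <;> simp <;> fun_prop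
  have hcont : Continuous fun w : ℝ × ℝ => cosProd k l w * h ![w.1, w.2] := (continuous_cosProd k l).mul hF
  unfold cosMoment
  have h1 : ∀ s, Real.cos (k * s) * (∫ u in (-π)..π, Real.cos (l * u) * h ![s, u]) =
      ∫ u in (-π)..π, cosProd k l (s, u) * h ![s, u] := by
    intro s
    rw [← intervalIntegral.integral_const_mul]
    exact intervalIntegral.integral_congr fun u _ => by simp only [cosProd]; ring
  simp_rw [h1]
  rw [intervalIntegral.integral_of_le hππ]
  simp_rw [intervalIntegral.integral_of_le hππ]
  rw [MeasureTheory.integral_prod _ (integrable_jmeas_of_continuous hcont)]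

/-- **BESSEL (finite, two-dimensional)**: `Σ_{k,l ≤ K} A_h(k,l)²/(cosNorm k · cosNorm l) ≤ ∫ h²` over the square. -/
theorem bessel_cosMoment (hh : Continuous h) (K : ℕ) :
    ∑ κ ∈ range (K + 1) ×ˢ range (K + 1), cosMoment h κ.1 κ.2 ^ 2 / (cosNorm κ.1 * cosNorm κ.2) ≤
      ∫ w, (h ![w.1, w.2]) ^ 2 ∂jmeas := by
  set I := range (K + 1) ×ˢ range (K + 1) with hI
  set A : ℕ × ℕ → ℝ := fun κ => cosMoment h κ.1 κ.2 with hA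
  set N : ℕ × ℕ → ℝ := fun κ => cosNorm κ.1 * cosNorm κ.2 with hN
  have hNpos : ∀ κ, 0 < N κ := fun κ => mul_pos (cosNorm_pos _) (cosNorm_pos _)
  set c : ℕ × ℕ → ℝ := fun κ => A κ / N κ with hc
  set hw : ℝ × ℝ → ℝ := fun w => h ![w.1, w.2] with hhw
  have hF : Continuous hw := by
    refine hh.comp (continuous_pi fun i => ?_)
    fin_cases i <;> simp <;> fun_prop
  set S : ℝ × ℝ → ℝ := fun w => ∑ κ ∈ I, c κ * cosProd κ.1 κ.2 w with hS
  have hSc : Continuous S := continuous_finsetSum I fun κ _ => continuous_const.mul (continuous_cosProd _ _)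
  -- the three integrals
  have hA_int : ∀ κ, ∫ w, cosProd κ.1 κ.2 w * hw w ∂jmeas = A κ := fun κ => (cosMoment_eq_integral_prod hh κ.1 κ.2).symm
  have h_hS : ∫ w, hw w * S w ∂jmeas = ∑ κ ∈ I, c κ * A κ := by
    have e : (fun w => hw w * S w) = fun w => ∑ κ ∈ I, c κ * (cosProd κ.1 κ.2 w * hw w) := by
      funext w; simp only [hS, Finset.mul_sum]; exact Finset.sum_congr rfl fun κ _ => by ring
    have hi : ∀ κ ∈ I, Integrable (fun w : ℝ × ℝ => c κ * (cosProd κ.1 κ.2 w * hw w)) jmeas := fun κ _ =>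
      (integrable_jmeas_of_continuous (show Continuous fun w : ℝ × ℝ => cosProd κ.1 κ.2 w * hw w from
        (continuous_cosProd _ _).mul hF)).const_mul _
    rw [e, integral_finsetSum I hi]
    exact Finset.sum_congr rfl fun κ _ => by rw [MeasureTheory.integral_const_mul, hA_int]
  have h_SS : ∫ w, S w * S w ∂jmeas = ∑ κ ∈ I, c κ ^ 2 * N κ := by
    have e : (fun w => S w * S w) = fun w => ∑ κ ∈ I, ∑ κ' ∈ I, c κ * c κ' * (cosProd κ.1 κ.2 w * cosProd κ'.1 κ'.2 w) := by
      funext w; simp only [hS, Finset.sum_mul_sum]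
      exact Finset.sum_congr rfl fun κ _ => Finset.sum_congr rfl fun κ' _ => by ring
    have hi : ∀ κ ∈ I, ∀ κ' ∈ I, Integrable (fun w : ℝ × ℝ => c κ * c κ' * (cosProd κ.1 κ.2 w * cosProd κ'.1 κ'.2 w)) jmeas :=
      fun κ _ κ' _ => (integrable_jmeas_of_continuous (show Continuous fun w : ℝ × ℝ => cosProd κ.1 κ.2 w * cosProd κ'.1 κ'.2 w from
        (continuous_cosProd _ _).mul (continuous_cosProd _ _))).const_mul _
    have hi' : ∀ κ ∈ I, Integrable (fun w : ℝ × ℝ => ∑ κ' ∈ I, c κ * c κ' * (cosProd κ.1 κ.2 w * cosProd κ'.1 κ'.2 w)) jmeas :=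
      fun κ hκ => integrable_finsetSum I (hi κ hκ)
    rw [e, integral_finsetSum I hi']
    refine Finset.sum_congr rfl fun κ hκ => ?_
    rw [integral_finsetSum I (hi κ hκ)]
    simp_rw [MeasureTheory.integral_const_mul, integral_cosProd_mul_cosProd]
    rw [Finset.sum_eq_single κ]
    · rw [if_pos rfl, if_pos rfl]; simp only [hN]; ring
    · intro κ' _ hne
      have : ¬ (κ.1 = κ'.1 ∧ κ.2 = κ'.2) := fun hh' => hne (Prod.ext hh'.1 hh'.2).symm
      rcases not_and_or.mp this with h1 | h2
      · rw [if_neg h1]; ring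
      · rw [if_neg h2]; ring
    · intro hκ'; exact absurd hκ hκ'
  -- positivity of `∫ (hw − S)²`
  have hpos : 0 ≤ ∫ w, (hw w - S w) ^ 2 ∂jmeas := integral_nonneg fun w => sq_nonneg _
  have hexp : ∫ w, (hw w - S w) ^ 2 ∂jmeas =
      (∫ w, hw w ^ 2 ∂jmeas) - 2 * ∫ w, hw w * S w ∂jmeas + ∫ w, S w * S w ∂jmeas := by
    have i1 : Integrable (fun w => hw w ^ 2) jmeas := integrable_jmeas_of_continuous (hF.pow 2)
    have i2 : Integrable (fun w => 2 * (hw w * S w)) jmeas := (integrable_jmeas_of_continuous (hF.mul hSc)).const_mul _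
    have i3 : Integrable (fun w => S w * S w) jmeas := integrable_jmeas_of_continuous (hSc.mul hSc)
    have i12 : Integrable (fun w => hw w ^ 2 - 2 * (hw w * S w)) jmeas := i1.sub i2
    have e : (fun w => (hw w - S w) ^ 2) = fun w => (hw w ^ 2 - 2 * (hw w * S w)) + S w * S w := by funext w; ring
    rw [e, integral_add i12 i3, integral_sub i1 i2, MeasureTheory.integral_const_mul]
  rw [hexp, h_hS, h_SS] at hpos
  -- `Σ c A = Σ A²/N = Σ c² N`
  have e1 : ∑ κ ∈ I, c κ * A κ = ∑ κ ∈ I, A κ ^ 2 / N κ :=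
    Finset.sum_congr rfl fun κ _ => by simp only [hc]; field_simp
  have e2 : ∑ κ ∈ I, c κ ^ 2 * N κ = ∑ κ ∈ I, A κ ^ 2 / N κ :=
    Finset.sum_congr rfl fun κ _ => by simp only [hc]; field_simp [(hNpos κ).ne']
  rw [e1, e2] at hpos
  show ∑ κ ∈ I, A κ ^ 2 / N κ ≤ ∫ w, hw w ^ 2 ∂jmeas
  linarith

/-- The square's measure has total mass `(2π)²`. -/
theorem jmeas_univ_toReal : ((jmeas : Measure (ℝ × ℝ)) Set.univ).toReal = (2 * π) * (2 * π) := by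
  rw [← Set.univ_prod_univ, Measure.prod_prod]
  simp only [Measure.restrict_apply_univ, Real.volume_Ioc]
  rw [ENNReal.toReal_mul, ENNReal.toReal_ofReal (by linarith [Real.pi_pos])]
  ring

/-- **`Σ_{k,l ≤ K} |A_h(k,l)| ≤ 4π²(K+1)·sup|h|`** (Bessel + Cauchy–Schwarz: the loss is `K + 1`, not `(K+1)²`). -/
theorem sum_abs_cosMoment_le (hh : Continuous h) {A : ℝ} (hA : ∀ p, |h p| ≤ A) (K : ℕ) :
    ∑ κ ∈ range (K + 1) ×ˢ range (K + 1), |cosMoment h κ.1 κ.2| ≤ 4 * π ^ 2 * (K + 1) * A := by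
  set I := range (K + 1) ×ˢ range (K + 1) with hI
  have hA0 : 0 ≤ A := le_trans (abs_nonneg _) (hA 0)
  set N : ℕ × ℕ → ℝ := fun κ => cosNorm κ.1 * cosNorm κ.2 with hN
  have hNpos : ∀ κ, 0 < N κ := fun κ => mul_pos (cosNorm_pos _) (cosNorm_pos _)
  have hNle : ∀ κ, N κ ≤ (2 * π) * (2 * π) := fun κ =>
    mul_le_mul (cosNorm_le _) (cosNorm_le _) (cosNorm_pos _).le (by positivity)
  -- Bessel and the sup bound of `∫ h²`
  have hB := bessel_cosMoment hh K
  have hF : Continuous fun w : ℝ × ℝ => h ![w.1, w.2] := by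
    refine hh.comp (continuous_pi fun i => ?_)
    fin_cases i <;> simp <;> fun_prop
  have hint : ∫ w, (h ![w.1, w.2]) ^ 2 ∂jmeas ≤ (2 * π) * (2 * π) * A ^ 2 := by
    calc ∫ w, (h ![w.1, w.2]) ^ 2 ∂jmeas ≤ ∫ w, A ^ 2 ∂jmeas := by
          refine integral_mono_of_nonneg (Filter.Eventually.of_forall fun w => sq_nonneg _) (integrable_const _)
            (Filter.Eventually.of_forall fun w => ?_)
          have := hA ![w.1, w.2]
          exact sq_le_sq' (abs_le.mp this).1 (abs_le.mp this).2
      _ = (2 * π) * (2 * π) * A ^ 2 := by rw [MeasureTheory.integral_const, smul_eq_mul, MeasureTheory.measureReal_def, jmeas_univ_toReal]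
  -- Cauchy–Schwarz with weights `√N`
  have hCS := Finset.sum_mul_sq_le_sq_mul_sq I (fun κ => Real.sqrt (N κ)) (fun κ => |cosMoment h κ.1 κ.2| / Real.sqrt (N κ))
  have hprod : ∀ κ ∈ I, Real.sqrt (N κ) * (|cosMoment h κ.1 κ.2| / Real.sqrt (N κ)) = |cosMoment h κ.1 κ.2| := by
    intro κ _
    have := Real.sqrt_pos.mpr (hNpos κ)
    field_simp
  rw [Finset.sum_congr rfl hprod] at hCS
  have hs1 : ∑ κ ∈ I, Real.sqrt (N κ) ^ 2 ≤ ((K + 1 : ℝ) * (K + 1)) * ((2 * π) * (2 * π)) := by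
    calc ∑ κ ∈ I, Real.sqrt (N κ) ^ 2 = ∑ κ ∈ I, N κ := Finset.sum_congr rfl fun κ _ => Real.sq_sqrt (hNpos κ).le
      _ ≤ ∑ κ ∈ I, (2 * π) * (2 * π) := Finset.sum_le_sum fun κ _ => hNle κ
      _ = ((K + 1 : ℝ) * (K + 1)) * ((2 * π) * (2 * π)) := by
          rw [Finset.sum_const, hI, Finset.card_product, Finset.card_range, nsmul_eq_mul]; push_cast; ring
  have hs2 : ∑ κ ∈ I, (|cosMoment h κ.1 κ.2| / Real.sqrt (N κ)) ^ 2 ≤ (2 * π) * (2 * π) * A ^ 2 := by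
    calc ∑ κ ∈ I, (|cosMoment h κ.1 κ.2| / Real.sqrt (N κ)) ^ 2 = ∑ κ ∈ I, cosMoment h κ.1 κ.2 ^ 2 / (cosNorm κ.1 * cosNorm κ.2) :=
          Finset.sum_congr rfl fun κ _ => by rw [div_pow, sq_abs, Real.sq_sqrt (hNpos κ).le]
      _ ≤ _ := hB.trans hint
  have hL0 : 0 ≤ ∑ κ ∈ I, |cosMoment h κ.1 κ.2| := Finset.sum_nonneg fun κ _ => abs_nonneg _
  have hsq : (∑ κ ∈ I, |cosMoment h κ.1 κ.2|) ^ 2 ≤ (4 * π ^ 2 * (K + 1) * A) ^ 2 := by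
    calc (∑ κ ∈ I, |cosMoment h κ.1 κ.2|) ^ 2
        ≤ (∑ κ ∈ I, Real.sqrt (N κ) ^ 2) * ∑ κ ∈ I, (|cosMoment h κ.1 κ.2| / Real.sqrt (N κ)) ^ 2 := hCS
      _ ≤ ((K + 1 : ℝ) * (K + 1)) * ((2 * π) * (2 * π)) * ((2 * π) * (2 * π) * A ^ 2) :=
          mul_le_mul hs1 hs2 (Finset.sum_nonneg fun κ _ => sq_nonneg _) (by positivity)
      _ = (4 * π ^ 2 * (K + 1) * A) ^ 2 := by ring
  exact (pow_le_pow_iff_left₀ hL0 (by positivity) two_ne_zero).mp hsq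

end Bessel

/-! ## §4 The Bernstein-type bound of the low part -/

section LowBound

variable (d : ℕ) {g : (Fin 2 → ℝ) → ℝ}

/-- **The coefficient weight of the low frame**: `coeffNorm i (jlowFrame d g) ≤ 12(2d+1)(1+4d)ⁱ·A` for `g` continuous with `|g| ≤ A`
(`|ĵ_k| ≤ 1/π`, `Σ|A_g| ≤ 4π²(2d+1)A`, `Σ|A_{𝒥g}| ≤ 4π²(2d+1)A` since `|𝒥g| ≤ A`). -/
theorem coeffNorm_jlowFrame_le (hg : Continuous g) {A : ℝ} (hA : ∀ p, |g p| ≤ A) (i : ℕ) :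
    (jlowFrame d g).coeffNorm i ≤ 12 * (2 * d + 1) * (1 + 4 * d) ^ i * A := by
  have hA0 : 0 ≤ A := le_trans (abs_nonneg _) (hA 0)
  have hPc : Continuous (jsmooth d g) := continuous_jsmooth d hg
  have hPA : ∀ p, |jsmooth d g p| ≤ A := fun p => abs_jsmooth_le d hg hA p
  have hS1 := sum_abs_cosMoment_le hg hA (d + d)
  have hS2 := sum_abs_cosMoment_le hPc hPA (d + d)
  set I := range (d + d + 1) ×ˢ range (d + d + 1) with hI
  -- termwise bound
  have hterm : ∀ κ ∈ I, (1 + (κ.1 : ℝ) + κ.2) ^ i * |(jlowFrame d g).coeff κ.1 κ.2| ≤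
      (1 + 4 * d) ^ i * (1 / π ^ 2) * (2 * |cosMoment g κ.1 κ.2| + |cosMoment (jsmooth d g) κ.1 κ.2|) := by
    intro κ hκ
    rw [hI, Finset.mem_product, Finset.mem_range, Finset.mem_range] at hκ
    have hk : κ.1 ≤ d + d := by omega
    have hl : κ.2 ≤ d + d := by omega
    have h1 : (1 + (κ.1 : ℝ) + κ.2) ^ i ≤ (1 + 4 * d) ^ i := by
      apply pow_le_pow_left₀ (by positivity)
      have : (κ.1 : ℝ) ≤ d + d := by exact_mod_cast hk
      have : (κ.2 : ℝ) ≤ d + d := by exact_mod_cast hl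
      linarith
    have hj1 := abs_jkerCoeff_le d hk
    have hj2 := abs_jkerCoeff_le d hl
    have hcoeff : |(jlowFrame d g).coeff κ.1 κ.2| ≤ (1 / π ^ 2) * (2 * |cosMoment g κ.1 κ.2| + |cosMoment (jsmooth d g) κ.1 κ.2|) := by
      show |jkerCoeff d κ.1 * jkerCoeff d κ.2 * (2 * cosMoment g κ.1 κ.2 - cosMoment (jsmooth d g) κ.1 κ.2)| ≤ _
      rw [abs_mul, abs_mul]
      have htri : |2 * cosMoment g κ.1 κ.2 - cosMoment (jsmooth d g) κ.1 κ.2| ≤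
          2 * |cosMoment g κ.1 κ.2| + |cosMoment (jsmooth d g) κ.1 κ.2| := by
        calc _ ≤ |2 * cosMoment g κ.1 κ.2| + |cosMoment (jsmooth d g) κ.1 κ.2| := abs_sub _ _
          _ = _ := by rw [abs_mul, abs_two]
      have hjj : |jkerCoeff d κ.1| * |jkerCoeff d κ.2| ≤ 1 / π ^ 2 := by
        calc |jkerCoeff d κ.1| * |jkerCoeff d κ.2| ≤ (1 / π) * (1 / π) :=
              mul_le_mul hj1 hj2 (abs_nonneg _) (by positivity)
          _ = 1 / π ^ 2 := by ring
      exact mul_le_mul hjj htri (abs_nonneg _) (by positivity)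
    calc (1 + (κ.1 : ℝ) + κ.2) ^ i * |(jlowFrame d g).coeff κ.1 κ.2|
        ≤ (1 + 4 * d) ^ i * ((1 / π ^ 2) * (2 * |cosMoment g κ.1 κ.2| + |cosMoment (jsmooth d g) κ.1 κ.2|)) :=
          mul_le_mul h1 hcoeff (abs_nonneg _) (by positivity)
      _ = _ := by ring
  -- sum
  have hsum : (jlowFrame d g).coeffNorm i = ∑ κ ∈ I, (1 + (κ.1 : ℝ) + κ.2) ^ i * |(jlowFrame d g).coeff κ.1 κ.2| := by
    rw [TrigPolyC4v.coeffNorm, jlowFrame_degree, hI, Finset.sum_product]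
  rw [hsum]
  calc ∑ κ ∈ I, (1 + (κ.1 : ℝ) + κ.2) ^ i * |(jlowFrame d g).coeff κ.1 κ.2|
      ≤ ∑ κ ∈ I, (1 + 4 * d) ^ i * (1 / π ^ 2) * (2 * |cosMoment g κ.1 κ.2| + |cosMoment (jsmooth d g) κ.1 κ.2|) :=
        Finset.sum_le_sum hterm
    _ = (1 + 4 * d) ^ i * (1 / π ^ 2) * (2 * ∑ κ ∈ I, |cosMoment g κ.1 κ.2| + ∑ κ ∈ I, |cosMoment (jsmooth d g) κ.1 κ.2|) := by
        rw [← Finset.mul_sum, Finset.sum_add_distrib, Finset.mul_sum]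
    _ ≤ (1 + 4 * d) ^ i * (1 / π ^ 2) * (2 * (4 * π ^ 2 * ((d + d : ℕ) + 1) * A) + 4 * π ^ 2 * ((d + d : ℕ) + 1) * A) := by
        gcongr
    _ = 12 * (2 * d + 1) * (1 + 4 * d) ^ i * A := by
        have hπ : π ^ 2 ≠ 0 := by positivity
        field_simp
        push_cast
        ring

/-- **THE BERNSTEIN-TYPE BOUND OF THE LOW PART.**  For a symmetric frame `g` (continuous, `2π`-periodic, reflection- and swap-symmetric) with
`|g| ≤ A`: every derivative of `jlow d g = 2𝒥_dg − 𝒥_d²g` read on `ℝ²` satisfies `‖Dⁱ‖ ≤ 12(2d+1)(1+4d)ⁱ·A` — amplitude = the SUP of `g`,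
each derivative costs `≤ 1 + 4d`, extra loss `2d + 1`. -/
theorem norm_iteratedFDeriv_jlow_le (hg : Continuous g)
    (hper : ∀ (p : Fin 2 → ℝ) (z : Fin 2 → ℤ), g (fun i => p i + z i * (2 * π)) = g p)
    (hrefl : ∀ p : Fin 2 → ℝ, g ![p 0, -p 1] = g p) (hswap : ∀ p : Fin 2 → ℝ, g ![p 1, p 0] = g p)
    {A : ℝ} (hA : ∀ p, |g p| ≤ A) (i : ℕ) (q : Momentum) :
    ‖iteratedFDeriv ℝ i (fun q : Momentum => jlow d g (WithLp.ofLp q)) q‖ ≤ 12 * (2 * d + 1) * (1 + 4 * d) ^ i * A := by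
  have hfun : (fun q : Momentum => jlow d g (WithLp.ofLp q)) = evalM (jlowFrame d g) := by
    funext q; exact (eval_jlowFrame d hg hper hrefl hswap _).symm
  rw [hfun]
  exact (norm_iteratedFDeriv_evalM_le_coeffNorm _ i q).trans (coeffNorm_jlowFrame_le d hg hA i)

/-- The low part's SUP bound with constant 3: `|jlow d g| ≤ 3A`. -/
theorem abs_jlow_le (hg : Continuous g) {A : ℝ} (hA : ∀ p, |g p| ≤ A) (p : Fin 2 → ℝ) : |jlow d g p| ≤ 3 * A := by
  have h1 := abs_jsmooth_le d hg hA p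
  have h2 := abs_jsmooth_le d (continuous_jsmooth d hg) (fun p => abs_jsmooth_le d hg hA p) p
  rw [jlow_apply]
  calc |2 * jsmooth d g p - jsmooth d (jsmooth d g) p| ≤ |2 * jsmooth d g p| + |jsmooth d (jsmooth d g) p| := abs_sub _ _
    _ ≤ 2 * A + A := by rw [abs_mul, abs_two]; exact add_le_add (by linarith) h2
    _ = 3 * A := by ring

end LowBound

end Summit.HubbardSuperconductivity.HubbardSuperconductivity.Theorems.KLRegimeSplit

end
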